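import Literature.Probability.FitznerVanDerHofstad2017.MeanFieldD11AppDStep1
import Literature.Probability.FitznerVanDerHofstad2017.MeanFieldD11AppDCorr
import Literature.Probability.FitznerVanDerHofstad2017.NobleKSpaceRewriteFRem
import HarnessLib

/-!
# Mean-field behaviour at `d = 11` on the kernel App.-D line, VII: Appendix D DISCHARGED — `MeanField 11` from Assumption 4.3 and Prop. 2.2 alone

CITATION HEADER (PLACEMENT v2). Part of the certified REPRODUCTION of R. Fitzner, R. van der Hofstad, *Mean-field behavior for
nearest-neighbor percolation in d > 10*, EJP 22 (2017) no. 43 [FvdH17] and *Generalized approach to the non-backtracking lace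
expansion*, PTRF 169 (2017) 1041–1119 [NoBLE17]; build `lace`, seat lean2 (gen 13), module 13.  ADDITIVE: every record file
(`MeanFieldD11Cert` rev 6 = the certificate OF RECORD, `MeanFieldD11Inputs`, `NobleInstantiate`, `NobleAssumptions`, `BetaMap`) and
modules I–VI of this line are untouched; nothing here is a cited fact; no `def … : Prop`; `d = 11` only.

WHAT THIS MODULE DOES.  It composes two kernel theorems that landed within minutes of each other:
* `nobleSimplifiedFormAt_percolation₅` (`NobleKSpaceRewriteFRem`, module 3c-B of the App.-D reconstruction): [NoBLE17] Prop. 4.5(ii)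
  for the percolation split with ALL SIX App.-D constants `c_Φ, α_Φ, R_Φ, c_F, α_F, R_F` constructed and (D.2), (D.3), (D.4), (D.14),
  (D.32) PROVED — from the NoBLE equation at `p`, Assumption 4.3 at `p` with a well-formed record `i`, and the four decidable sign
  conditions (N1′)(N2)(N3)(N4) — concluding `NobleSimplifiedFormAt d p (nobleBetaOfInputsCorr d i)`, i.e. with the `βΔ` slot carrying
  the Step-4 bookkeeping constant `betaRfDeltaCorr` (programme note DIVERGENCE D65);
* `nobleCertificate_d11_corr` (`MeanFieldD11AppDCorr`, module VI of this line): every inequality of the input-level certificate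
  `P(γ', Γ)` of [NoBLE17] Def. 2.9 at `d = 11` for the tables `β^corr(inputsI)`, `β^corr(inputsO)`, with the free parameter `γ₂`
  re-chosen as `γ'₂ = 1.10845 ∈ [f2Bound(β^corr(inputsO)), Γ₂)` (`γ' = gammaD65`; `Γ`, `c_μ`, `c`, `bi`, `bo` of record), by `norm_num`;
with the side conditions (N1′)(N2)(N3) (`MeanFieldD11AppD`) and (N4) (`MeanFieldD11AppDStep1`, REFEREE W50.2) at the published records,
the NoBLE equations (`percolationNobleEquationAt_of_summable`) and the regime facts, into

  `meanField_full_d11_discharged : (S2a at p_I) → (S2b at p_I) → (∀ p ∈ (p_I, p_c), f(p) ≤ Γ → S2a ∧ S2b at p) → MeanField 11`.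

REMAINING HYPOTHESES (ANALYTIC, displayed binders, NOT CITABLE as typed; no named fact):
(S2a) [NoBLE17] Assumption 4.3 for the percolation split — the x-space diagrammatic bounds with the PUBLISHED constants: `inputsI` at
`p_I = 1/21`, `inputsO` at every `p ∈ (p_I, p_c)` with `f(p) ≤ Γ` ([FvdH17] §3–§5 with the Stage-1 numerics; programme nodes N35′, (T),
LEMMAS §21);  (S2b) [FvdH17] Prop. 2.2 — the weighted-diagram bounds `bi` at `p_I`, `bo` on the window.
NO hypothesis of [NoBLE17] App. D remains: (D.3) and (D.32), displayed as `hIF`/`hRF` in modules I–V, are now theorems of the tree.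

EPISTEMIC STATUS / SCOPE (REFEREE ORDERS v52 (1), R276/R284/R288 vocabulary).  This is the `d = 11` sentence ON THE KERNEL APP.-D LINE
(β-map as wired, DIVERGENCE D29) AT THE BOOKKEEPING TABLE `β^corr` (D65) WITH THE FREE PARAMETER `γ'` — a kernel theorem with displayed
analytic hypotheses; it is NOT the certificate of record (`MeanFieldD11Cert` rev 6: tables `Bi`/`Bo` of the two engines, `γ = gammaC`),
whose treatment of D65 (Cert rev 7, `γ₂` only) is the referee's decision after the two-engine confirmation.  FREE-PARAMETER CLAUSE
(REFEREE2 ref2-R42/R43, REFEREE W54.2): on this line the record's free parameter `γ₂ = 1.108259` (`gammaC 1`) is INFEASIBLE —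
`f2Bound (β^corr(inputsO)) > γ₂` is the kernel theorem `D11.f2BoundCorr_o_not_le_gammaC` (module `MeanFieldD11AppDCorr`) — and
`γ'₂ = 1.10845` (`gammaD65 1`, inside `[f2Bound(β^corr(inputsO)), Γ₂)`, `Γ₂ = 1.1084502`) is used instead; `γ₁`, `γ₃`, `Γ` are the
record's.  The sentences of record are unchanged.  No sentence about any `d ≠ 11`.

REVISION 2 (lean2 gen 14): module docstring only (the free-parameter clause above); no declaration, statement or proof changed.

f₃-TABLE CLAUSE (REFEREE v56 R319 (e) = ORDERS v56 W56.2; REFEREE2 v48 ref2-R44 (b)): `bo` here is rev 6's β_Δ-WIRED f₃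
table (`Percolation.nb` cell [144] passes `1/(α_F,low − β_Δ)` as the last argument of every `s = o` `BoundFThreeBound` cell, so the six
`bo` literals are functions of `β_Δ`, while `bi` is not); the corrected chain's `b_o` at this cell (O12g U(12,28)) exceeds `c001` on
engine B (finding C46-F3, ONE engine: `b_o,{0,0,1}/c001 = 1.000103` as coded, `1.000080` printed wiring, `> Γ₃ = 1`), so this is the
KERNEL SHAPE of the D65 certificate, not its corrected numerics — closing requires Cert rev 7 (O12g U(13,28), fallback O12h-B; two
engines; C46 BLOCKING).  In particular NO sentence of this module says that `P(γ', Γ)` holds at `β^corr` with CORRECTED f₃ tables: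
the kernel theorems below pair `β^corr(inputsO)` with the rev-6 `bo` literal, exactly as typed (valid as typed, R319 (e)).
REVISION 3 (lean2 gen 14, W56.2): module docstring only (the f₃-table clause); every declaration byte-identical to
revision 1 (p187648); revision 2 (p188359) added the free-parameter clause.

[cite: FitznerVanDerHofstad2017, Thm 1.1 / Cor. 1.3 (d = 11), Prop. 2.2, §2.4–§2.7, §3.5]
[cite: FitznerVanDerHofstad2016NoBLE, Thm 2.10, Prop. 2.11, Def. 2.9 (pp. 1060–1062); Prop. 4.5 (p. 1088); Assumption 4.3 (pp. 1086–1088); App. D (D.1)–(D.32) (pp. 1110–1117); Lemma 2.12 (p. 1063)]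
-/

namespace Literature.Probability.FitznerVanDerHofstad2017

open _root_.MeasureTheory _root_.Filter _root_.Topology Literature.Probability.LatticeModels
open Literature.Barriers.CriticalPhenomena Literature.Probability.Percolation
open scoped BigOperators

namespace D11

/-! ## 1. Prop. 4.5(ii) at `d = 11`, App. D discharged (table `β^corr`) -/

/-- **[NoBLE17] Prop. 4.5(ii) at `d = 11` on the window, App. D DISCHARGED**: Assumption 4.3 at `p` for the percolation split with the
published record `inputsO` gives the simplified NoBLE form with the table `β^corr(inputsO)`; (N1′)(N2)(N3)(N4), the regime, the NoBLE
equation, Assumption 4.1, the shifted-`α` symmetries and ALL of App. D are kernel theorems (`nobleSimplifiedFormAt_percolation₅`).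
[cite: FitznerVanDerHofstad2016NoBLE, Prop. 4.5 (p. 1088); App. D (D.1)–(D.32)] [cite: FitznerVanDerHofstad2017, §2.5 (d = 11), §3.5] -/
theorem nobleSimplifiedFormAt_d11_o₅ {p : unitInterval} (hp : p < criticalProbI 11) (hp0 : 0 < (p : ℝ))
    (h43 : NobleAssumption43At 11 p (percolationNobleSplit 11 p two_le_eleven hp) inputsO) :
    NobleSimplifiedFormAt 11 p (BetaMap.nobleBetaOfInputsCorr ((11 : ℕ) : ℝ) inputsO) :=
  nobleSimplifiedFormAt_percolation₅ two_le_eleven hp hp0 inputsO_WF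
    (percolationNobleEquationAt_of_summable two_le_eleven hp hp0 h43.xiAbs.2.1 fun ι => (h43.xiIotaAbs ι).2.1)
    h43 n1_inputsO n2_inputsO n3_inputsO n4_inputsO

/-- **[NoBLE17] Prop. 4.5(ii) at `d = 11`, initial point `p_I = 1/21`, App. D DISCHARGED** (as `nobleSimplifiedFormAt_d11_o₅`, record
`inputsI`). [cite: FitznerVanDerHofstad2016NoBLE, Prop. 4.5 (p. 1088); Assumption 4.3 (z = z_I); App. D] [cite: FitznerVanDerHofstad2017, §2.4–§2.5] -/
theorem nobleSimplifiedFormAt_d11_i₅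
    (h43 : NobleAssumption43At 11 (nbwThresholdI 11)
      (percolationNobleSplit 11 (nbwThresholdI 11) two_le_eleven (nbwThresholdI_lt_criticalProbI two_le_eleven)) inputsI) :
    NobleSimplifiedFormAt 11 (nbwThresholdI 11) (BetaMap.nobleBetaOfInputsCorr ((11 : ℕ) : ℝ) inputsI) :=
  have hp := nbwThresholdI_lt_criticalProbI two_le_eleven
  have hp0 : 0 < ((nbwThresholdI 11 : unitInterval) : ℝ) := nbwThresholdI_pos (by norm_num)
  nobleSimplifiedFormAt_percolation₅ two_le_eleven hp hp0 inputsI_WF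
    (percolationNobleEquationAt_of_summable two_le_eleven hp hp0 h43.xiAbs.2.1 fun ι => (h43.xiIotaAbs ι).2.1)
    h43 n1_inputsI n2_inputsI n3_inputsI n4_inputsI

/-! ## 2. The two oracle binders of Prop. 2.11 at the `β^corr` tables from (S2a) + (S2b) -/

/-- **The improvement-step binder at `d = 11`, App. D discharged**: for every `p ∈ (p_I, p_c)` under `f ≤ Γ`, (S2a) Assumption 4.3 with
`inputsO` and (S2b) `bo` give `NobleImprovementInputsAt` at the table `β^corr(inputsO)`. [cite: FitznerVanDerHofstad2016NoBLE, Prop. 4.5, Prop. 2.11] [cite: FitznerVanDerHofstad2017, Prop. 2.2; §2.5] -/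
theorem nobleImprovementInputsAt_d11_discharged
    (hS : ∀ (p : unitInterval) (hp : p ∈ Set.Ioo (nbwThresholdI 11) (criticalProbI 11)),
      (∀ j, Literature.Barriers.CriticalPhenomena.nobleF 11 cMuC cWeightsC j p ≤ GammaC j) →
        NobleAssumption43At 11 p (percolationNobleSplit 11 p two_le_eleven hp.2) inputsO ∧
        NobleWeightedDiagramBoundAt 11 p bo) :
    NobleImprovementInputsAt 11 cMuC cWeightsC GammaC (BetaMap.nobleBetaOfInputsCorr 11 inputsO) bo := by
  intro p hp hΓ
  obtain ⟨h43, hW⟩ := hS p hp hΓ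
  have hp0 : 0 < (p : ℝ) :=
    lt_trans (nbwThresholdI_pos (by norm_num)) (show ((nbwThresholdI 11 : unitInterval) : ℝ) < p by exact_mod_cast hp.1)
  have hS' := nobleSimplifiedFormAt_d11_o₅ hp.2 hp0 h43
  simp only [Nat.cast_ofNat] at hS'
  exact ⟨hS', hW⟩

/-- **The initial-step binder at `d = 11`, App. D discharged.** [cite: FitznerVanDerHofstad2016NoBLE, Prop. 4.5; Assumption 4.3 (z = z_I); Prop. 2.11] [cite: FitznerVanDerHofstad2017, Prop. 2.2; §2.4–§2.5] -/
theorem nobleInitialInputsAt_d11_discharged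
    (hI43 : NobleAssumption43At 11 (nbwThresholdI 11)
      (percolationNobleSplit 11 (nbwThresholdI 11) two_le_eleven (nbwThresholdI_lt_criticalProbI two_le_eleven)) inputsI)
    (hIW : NobleWeightedDiagramBoundAt 11 (nbwThresholdI 11) bi) :
    NobleInitialInputsAt 11 (BetaMap.nobleBetaOfInputsCorr 11 inputsI) bi := by
  have hS := nobleSimplifiedFormAt_d11_i₅ hI43
  simp only [Nat.cast_ofNat] at hS
  exact ⟨hS, hIW⟩

/-! ## 3. The `d = 11` sentence with App. D discharged -/

/-- **Mean-field behaviour at `d = 11` on the kernel App.-D line, Appendix D of [NoBLE17] DISCHARGED.**  REMAINING HYPOTHESES (ANALYTIC,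
NOT CITABLE as typed; no named fact): (S2a) [NoBLE17] Assumption 4.3 for the percolation split with the published constants — `inputsI`
at `p_I`, `inputsO` on `(p_I, p_c)` under `f ≤ Γ`; (S2b) [FvdH17] Prop. 2.2's weighted-diagram bounds `bi`, `bo`.  Everything else —
the NoBLE equations, Assumption 4.1, the regime, App. D Steps 1–5 on both sides ((D.2)–(D.4), (D.14), (D.32) with the bookkeeping
constant), and the certificate `P(γ', Γ)` at the `β^corr` tables — is a kernel theorem.  Conclusion: triangle condition, `θ(p_c) = 0`,
`β = 1` (bounded ratio) on `ℤ^11`.  Table `β^corr` / parameter `γ'`: see the module docstring (D65; not the certificate of record).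
[cite: FitznerVanDerHofstad2017, Thm 1.1 / Cor. 1.3 (d = 11: numerical verification re-run with certified arithmetic)]
[cite: FitznerVanDerHofstad2016NoBLE, Thm 2.10, Prop. 2.11, Prop. 4.5, App. D] -/
theorem meanField_d11_discharged
    (hI43 : NobleAssumption43At 11 (nbwThresholdI 11)
      (percolationNobleSplit 11 (nbwThresholdI 11) two_le_eleven (nbwThresholdI_lt_criticalProbI two_le_eleven)) inputsI)
    (hIW : NobleWeightedDiagramBoundAt 11 (nbwThresholdI 11) bi)
    (hS : ∀ (p : unitInterval) (hp : p ∈ Set.Ioo (nbwThresholdI 11) (criticalProbI 11)),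
      (∀ j, Literature.Barriers.CriticalPhenomena.nobleF 11 cMuC cWeightsC j p ≤ GammaC j) →
        NobleAssumption43At 11 p (percolationNobleSplit 11 p two_le_eleven hp.2) inputsO ∧
        NobleWeightedDiagramBoundAt 11 p bo) :
    TriangleCondition 11 ∧ PercolationContinuity 11 ∧ BetaEqOneBoundedRatio 11 :=
  meanField_d11_corr (nobleInitialInputsAt_d11_discharged hI43 hIW) (nobleImprovementInputsAt_d11_discharged hS)

/-- `θ(p_c) = 0` on `ℤ^11`, App. D discharged (hypotheses as in `meanField_d11_discharged`). [cite: FitznerVanDerHofstad2017, Cor. 1.3 (d = 11)] -/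
theorem percolationContinuity_d11_discharged
    (hI43 : NobleAssumption43At 11 (nbwThresholdI 11)
      (percolationNobleSplit 11 (nbwThresholdI 11) two_le_eleven (nbwThresholdI_lt_criticalProbI two_le_eleven)) inputsI)
    (hIW : NobleWeightedDiagramBoundAt 11 (nbwThresholdI 11) bi)
    (hS : ∀ (p : unitInterval) (hp : p ∈ Set.Ioo (nbwThresholdI 11) (criticalProbI 11)),
      (∀ j, Literature.Barriers.CriticalPhenomena.nobleF 11 cMuC cWeightsC j p ≤ GammaC j) →
        NobleAssumption43At 11 p (percolationNobleSplit 11 p two_le_eleven hp.2) inputsO ∧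
        NobleWeightedDiagramBoundAt 11 p bo) :
    PercolationContinuity 11 :=
  (meanField_d11_discharged hI43 hIW hS).2.1

/-- **[FvdH17] Cor. 1.3 at `d = 11` in full (`MeanField 11`), App. D discharged** (hypotheses as in `meanField_d11_discharged`; exponents
by `meanField_of_triangle`). [cite: FitznerVanDerHofstad2017, Cor. 1.3 (d = 11), EJP p. 6] -/
theorem meanField_full_d11_discharged
    (hI43 : NobleAssumption43At 11 (nbwThresholdI 11)
      (percolationNobleSplit 11 (nbwThresholdI 11) two_le_eleven (nbwThresholdI_lt_criticalProbI two_le_eleven)) inputsI)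
    (hIW : NobleWeightedDiagramBoundAt 11 (nbwThresholdI 11) bi)
    (hS : ∀ (p : unitInterval) (hp : p ∈ Set.Ioo (nbwThresholdI 11) (criticalProbI 11)),
      (∀ j, Literature.Barriers.CriticalPhenomena.nobleF 11 cMuC cWeightsC j p ≤ GammaC j) →
        NobleAssumption43At 11 p (percolationNobleSplit 11 p two_le_eleven hp.2) inputsO ∧
        NobleWeightedDiagramBoundAt 11 p bo) :
    MeanField 11 :=
  meanField_of_triangle (by norm_num) (meanField_d11_discharged hI43 hIW hS).1

end D11

end Literature.Probability.FitznerVanDerHofstad2017
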